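import Summits.BirchSwinnertonDyer.BirchSwinnertonDyer.Theorems.ClassRecordThreeCornerAtThreeWOfInputsE0Prime
import Summits.BirchSwinnertonDyer.BirchSwinnertonDyer.Theorems.ClassRecordThreeCornerAtThreeChebotarevKummerSupply
import Summits.BirchSwinnertonDyer.BirchSwinnertonDyer.Theses.KolyvaginRoadThree

/-!
# Crux 21420 `CornerAtThreeW`: the ITEMS-CLOSER for the r20 shape of `Lines/inert.lean` — (c′) DISCHARGED (cell `bsd-stepL`, seat `bsd-stepL-corner3-p2` g15 = lane B;
# `--supports stmt-BirchSwinnertonDyer-21420 --as helper`)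

WHY. After lane B g15's `ChebKummerThree.chebotarevKummerSupplyAtThree` (p658335, (c′) PROVED verbatim) and tam3-p1 g18's
`CarrierLocalE0.stub_carrierLocalE0AtThree` ((b) PROVED verbatim), the residual stub of the REGISTERED line r18 of crux 21420 reduces to (a)
`ShimuraWalk.PrimitivesWithSplitNormTDAtThree` ALONE (= r20). THIS FILE records the crux BY NAME from the r20 input list — the g14 closer
`CornerAtThreeWOfInputs.cornerAtThreeW_of_itemsR19` with its last binder's conjunct (c′) supplied by the theorem, and with the image-free Gross pair `hF2`
read from the ROUTE ITEM `Theses.ClassRecordThree.EulerHalfGrossPrintFacts` BY NAME (CR3 rev 35 ∕ KR3, item 27981 by dedup; planner RULING 70 «fold it into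
your next natural revision»): `cornerAtThreeW_of_itemsR20` ⊢ `Theses.ClassRecordThree.CornerAtThreeW` and the KR3 twin
`kolyvaginRoadThree_cornerAtThreeW_of_itemsR20`. The gate's `proof.conditional` audit list of these theorems IS 21420's phase-2 itemization in the r20 shape:
CR3 items ⟨PublishedInputsThree, ShimuraParametrizationDataNonempty, ShimuraCasselsTateLevelInputs, EulerHalfGrossPrintFacts⟩ BY NAME, (L) `CornerAtThreeStepL`
[open mathematics], the twist pair, the eight Kato-twin facts not in 19112, Pasten's component orders, Cai–Shu–Tian's Gross–Zagier, the printed primitives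
(inert ∕ guarded), the twin-lower supply, and (a). CONDITIONAL; no item closes by this file; BSD is proved for no curve.
References (locators only): [cite: Darmon2004, Prop. 3.10, Def. 3.12, Thm. 4.18] [cite: GrossLMS1991, §3, §6 p. 245, §9] [cite: Cox2013, Thm. 8.12, §9.A].
-/

set_option autoImplicit false
set_option linter.dupNamespace false -- `Summit.BirchSwinnertonDyer.BirchSwinnertonDyer` (summit = problem), tree-wide

noncomputable section

open scoped Classical NumberField
open WeierstrassCurve NumberField IsDedekindDomain
open Literature.NumberTheory.EllipticCurves Literature.NumberTheory.EllipticCurves.Rank1Residual Literature.NumberTheory.Automorphic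
open Summit.BirchSwinnertonDyer.Rank1Residual

namespace Summit.BirchSwinnertonDyer.BirchSwinnertonDyer.Theorems.CornerAtThreeWOfInputs

/-- **Crux 21420 BY NAME, r20 shape** (lane B g15): the r19 closer with the Chebotarev–Kummer conjunct (c′) of its last binder DISCHARGED by
`ChebKummerThree.chebotarevKummerSupplyAtThree` and the Gross pair read from the route item `EulerHalfGrossPrintFacts`; the residual binder is (a)
`ShimuraWalk.PrimitivesWithSplitNormTDAtThree` ALONE (print-level: Darmon 2004 Prop. 3.10 ∕ Def. 3.12 ∕ Thm. 4.18 for the CM family of `X_{N⁺,N⁻}`).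
CONDITIONAL; the item does NOT close by this file. [cite: Darmon2004, Prop. 3.10, Def. 3.12, Thm. 4.18] [cite: GrossLMS1991, §3, §9] -/
theorem cornerAtThreeW_of_itemsR20
    (hP : Summit.BirchSwinnertonDyer.BirchSwinnertonDyer.Theses.ClassRecordThree.PublishedInputsThree)
    (hJL : Summit.BirchSwinnertonDyer.BirchSwinnertonDyer.Theses.ClassRecordThree.ShimuraParametrizationDataNonempty)
    (hCT : Summit.BirchSwinnertonDyer.BirchSwinnertonDyer.Theses.ClassRecordThree.ShimuraCasselsTateLevelInputs)
    (hF2 : Summit.BirchSwinnertonDyer.BirchSwinnertonDyer.Theses.ClassRecordThree.EulerHalfGrossPrintFacts)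
    (hS : Summit.BirchSwinnertonDyer.BirchSwinnertonDyer.Theorems.CornerAtThreeStepL)
    (hL : Summit.BirchSwinnertonDyer.BirchSwinnertonDyer.Theorems.CornerAtThreeTwistLower)
    (hμ : Summit.BirchSwinnertonDyer.BirchSwinnertonDyer.Theorems.CornerAtThreeTwistMuAn)
    (hKato8 :
      Literature.NumberTheory.EllipticCurves.SteinWuthrich2013.thm61_splitMultiplicative ∧
      (∀ (W : WeierstrassCurve ℚ) [W.IsElliptic] [W.IsGloballyMinimal] (p : ℕ) [Fact p.Prime],
        Literature.NumberTheory.EllipticCurves.greenberg_stevens W p) ∧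
      Literature.NumberTheory.EllipticCurves.Kato2004.thm12_4 ∧
      Literature.NumberTheory.EllipticCurves.Kato2004.exists_multDivisibilityInputs_nonsplit ∧
      Literature.NumberTheory.EllipticCurves.Kato2004.exists_multDivisibilityInputs_split ∧
      Literature.NumberTheory.EllipticCurves.Greenberg1999.thm15_isTorsion_multiplicative_rat ∧
      Literature.NumberTheory.EllipticCurves.Wuthrich2014.corollary18_padicLFunction_mem_iwasawaAlgebra_multiplicative ∧
      Literature.NumberTheory.EllipticCurves.Kato2004.exists_multDivisibilityInputs_fine)
    (hCO : PastenShimura2024_componentOrders)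
    (hGZc : shimuraCurve_heegnerPoint_grossZagier)
    (hPrim : Literature.NumberTheory.EllipticCurves.shimuraCurve_heegnerSystem_primitivesAtThreeInert)
    (hPrimG : Literature.NumberTheory.EllipticCurves.shimuraCurve_heegnerSystem_primitivesAtThreeGuarded)
    (hTL3 : Summit.BirchSwinnertonDyer.BirchSwinnertonDyer.Theorems.CornerAtThreeFHTwinLowerSupply)
    (hres : Summit.BirchSwinnertonDyer.BirchSwinnertonDyer.Theorems.ShimuraWalk.PrimitivesWithSplitNormTDAtThree) :
    Summit.BirchSwinnertonDyer.BirchSwinnertonDyer.Theses.ClassRecordThree.CornerAtThreeW :=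
  cornerAtThreeW_of_itemsR19 hP hJL hCT hS hL hμ hF2 hKato8 hCO hGZc hPrim hPrimG hTL3
    ⟨hres, ChebKummerThree.chebotarevKummerSupplyAtThree⟩

/-- **The `KolyvaginRoadThree` twin, r20 shape** (the two route decls are the same term). CONDITIONAL; the item does NOT close by this file.
[cite: Darmon2004, Prop. 3.10, Def. 3.12, Thm. 4.18] [cite: GrossLMS1991, §3, §9] -/
theorem kolyvaginRoadThree_cornerAtThreeW_of_itemsR20
    (hP : Summit.BirchSwinnertonDyer.BirchSwinnertonDyer.Theses.ClassRecordThree.PublishedInputsThree)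
    (hJL : Summit.BirchSwinnertonDyer.BirchSwinnertonDyer.Theses.ClassRecordThree.ShimuraParametrizationDataNonempty)
    (hCT : Summit.BirchSwinnertonDyer.BirchSwinnertonDyer.Theses.ClassRecordThree.ShimuraCasselsTateLevelInputs)
    (hF2 : Summit.BirchSwinnertonDyer.BirchSwinnertonDyer.Theses.KolyvaginRoadThree.EulerHalfGrossPrintFacts)
    (hS : Summit.BirchSwinnertonDyer.BirchSwinnertonDyer.Theorems.CornerAtThreeStepL)
    (hL : Summit.BirchSwinnertonDyer.BirchSwinnertonDyer.Theorems.CornerAtThreeTwistLower)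
    (hμ : Summit.BirchSwinnertonDyer.BirchSwinnertonDyer.Theorems.CornerAtThreeTwistMuAn)
    (hKato8 :
      Literature.NumberTheory.EllipticCurves.SteinWuthrich2013.thm61_splitMultiplicative ∧
      (∀ (W : WeierstrassCurve ℚ) [W.IsElliptic] [W.IsGloballyMinimal] (p : ℕ) [Fact p.Prime],
        Literature.NumberTheory.EllipticCurves.greenberg_stevens W p) ∧
      Literature.NumberTheory.EllipticCurves.Kato2004.thm12_4 ∧
      Literature.NumberTheory.EllipticCurves.Kato2004.exists_multDivisibilityInputs_nonsplit ∧
      Literature.NumberTheory.EllipticCurves.Kato2004.exists_multDivisibilityInputs_split ∧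
      Literature.NumberTheory.EllipticCurves.Greenberg1999.thm15_isTorsion_multiplicative_rat ∧
      Literature.NumberTheory.EllipticCurves.Wuthrich2014.corollary18_padicLFunction_mem_iwasawaAlgebra_multiplicative ∧
      Literature.NumberTheory.EllipticCurves.Kato2004.exists_multDivisibilityInputs_fine)
    (hCO : PastenShimura2024_componentOrders)
    (hGZc : shimuraCurve_heegnerPoint_grossZagier)
    (hPrim : Literature.NumberTheory.EllipticCurves.shimuraCurve_heegnerSystem_primitivesAtThreeInert)
    (hPrimG : Literature.NumberTheory.EllipticCurves.shimuraCurve_heegnerSystem_primitivesAtThreeGuarded)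
    (hTL3 : Summit.BirchSwinnertonDyer.BirchSwinnertonDyer.Theorems.CornerAtThreeFHTwinLowerSupply)
    (hres : Summit.BirchSwinnertonDyer.BirchSwinnertonDyer.Theorems.ShimuraWalk.PrimitivesWithSplitNormTDAtThree) :
    Summit.BirchSwinnertonDyer.BirchSwinnertonDyer.Theses.KolyvaginRoadThree.CornerAtThreeW :=
  cornerAtThreeW_of_itemsR20 hP hJL hCT hF2 hS hL hμ hKato8 hCO hGZc hPrim hPrimG hTL3 hres

end Summit.BirchSwinnertonDyer.BirchSwinnertonDyer.Theorems.CornerAtThreeWOfInputs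

end
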